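import Mathlib
import HarnessLib

/-!
# Programme V4U, package T2 (a): memberships in `I₆` and `I₆²` with explicit cofactors (`T'`, `H'`, `M`, `Δ₇`)

(crux stmt-ResolutionOfSingularities-15640 `WildQuotients.WildQuotientResolution`, line `Sketch`,
sector `|G| = p`; programme V4U of `L/w45c/CHAIN.md` v6 §4 row stub-2, design of record
`L/w45c/V4U-DESIGN.md` §3/§6 T2 (a); [OURS · L1 W4.5c] — NOT a statement of any manuscript; replaces the
role of no printed item.)

Letters (V4U-DESIGN §1/§3): `I₆ = (x_a², x_ax_b², x_ax_bx_c, x_ax_c³, x_b³, x_b²x_c², x_bx_c⁴, x_c⁶) ⊆ k[x]`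
(VECTOR OF RECORD `![X a ^ 2, X a * X b ^ 2, X a * X b * X c, X a * X c ^ 3, X b ^ 3, X b ^ 2 * X c ^ 2,
X b * X c ^ 4, X c ^ 6]`), the `J₄`-invariants `H' = x_b² − x_ax_b − 2x_ax_c`,
`T' = x_b³ − 3x_ax_bx_c + 3x_a²x_d − x_a²x_b`, the slice `M = x_bx_c − x_b² + x_ax_b − 3x_ax_d`
(`σM = M + H'`). This file: `T', H'², x_aH', MH', x_aM, M² ∈ I₆`, `H'³, T'² ∈ I₆²`, and
`∃ Δ₇ ∈ I₆², x_a² Δ₇ = T'H'³ − T'³ + 3x_aT'²H'` — the memberships behind the inverse dictionary of the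
twisted root chart (`s² ↤ (H'²/T')θ⁻¹`, …, `η ↤ (Δ₇/T'²)θ⁻¹`). The cofactor tables are res-L1-w45c-plan-1's
kernel-checked `L/w45c/W45cPlanSignaturesV6.lean` V6.1 `CofactorTables`, restated as ring identities in
four free letters and instantiated at `(X a, X b, X c, X d)`.
-/

-- single-problem summit: the doubled namespace component `ResolutionOfSingularities` is forced
set_option linter.dupNamespace false

noncomputable section

open MvPolynomial

namespace Summit.ResolutionOfSingularities.ResolutionOfSingularities.Theorems.WildQuotientResolution.JordanFour

section RingIdentities

/-! ### Cofactor identities (plan-1's V6.1 tables), as ring identities in four free letters -/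

variable {A : Type*} [CommRing A] (a b c d : A)

/-- `T'` on the generators `(x_a², x_ax_bx_c, x_b³)`. [folklore] -/
theorem tprime_eq_cofactors : b ^ 3 - 3 * a * b * c + 3 * a ^ 2 * d - a ^ 2 * b =
    (-b + 3 * d) * (a ^ 2) + 0 * (a * b ^ 2) + (-3) * (a * b * c) + 0 * (a * c ^ 3) +
      1 * (b ^ 3) + 0 * (b ^ 2 * c ^ 2) + 0 * (b * c ^ 4) + 0 * (c ^ 6) := by ring

/-- `H'²` on the generators. [folklore] -/
theorem hsq_eq_cofactors : (b ^ 2 - a * b - 2 * a * c) ^ 2 =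
    (b ^ 2 + 4 * b * c + 4 * c ^ 2) * (a ^ 2) + (-2 * b - 4 * c) * (a * b ^ 2) + 0 * (a * b * c) +
      0 * (a * c ^ 3) + b * (b ^ 3) + 0 * (b ^ 2 * c ^ 2) + 0 * (b * c ^ 4) + 0 * (c ^ 6) := by ring

/-- `x_a H'` on the generators. [folklore] -/
theorem xaH_eq_cofactors : a * (b ^ 2 - a * b - 2 * a * c) =
    (-b - 2 * c) * (a ^ 2) + 1 * (a * b ^ 2) + 0 * (a * b * c) +
      0 * (a * c ^ 3) + 0 * (b ^ 3) + 0 * (b ^ 2 * c ^ 2) + 0 * (b * c ^ 4) + 0 * (c ^ 6) := by ring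

/-- `M H'` on the generators. [folklore] -/
theorem mH_eq_cofactors : (b * c - b ^ 2 + a * b - 3 * a * d) * (b ^ 2 - a * b - 2 * a * c) =
    (-b ^ 2 - 2 * b * c + 3 * b * d + 6 * c * d) * (a ^ 2) + (2 * b + c - 3 * d) * (a * b ^ 2) +
      (-2 * c) * (a * b * c) + 0 * (a * c ^ 3) + (-b + c) * (b ^ 3) + 0 * (b ^ 2 * c ^ 2) +
      0 * (b * c ^ 4) + 0 * (c ^ 6) := by ring

/-- `x_a M` on the generators. [folklore] -/
theorem xaM_eq_cofactors : a * (b * c - b ^ 2 + a * b - 3 * a * d) =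
    (b - 3 * d) * (a ^ 2) + (-1) * (a * b ^ 2) + 1 * (a * b * c) +
      0 * (a * c ^ 3) + 0 * (b ^ 3) + 0 * (b ^ 2 * c ^ 2) + 0 * (b * c ^ 4) + 0 * (c ^ 6) := by ring

/-- `M²` on the generators. [folklore] -/
theorem msq_eq_cofactors : (b * c - b ^ 2 + a * b - 3 * a * d) ^ 2 =
    (b ^ 2 - 6 * b * d + 9 * d ^ 2) * (a ^ 2) + (-2 * b + 2 * c + 6 * d) * (a * b ^ 2) +
      (-6 * d) * (a * b * c) + 0 * (a * c ^ 3) + (b - 2 * c) * (b ^ 3) + 1 * (b ^ 2 * c ^ 2) +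
      0 * (b * c ^ 4) + 0 * (c ^ 6) := by ring

/-- `H'³` on the products of generators. [folklore] -/
theorem hcube_eq_cofactors : (b ^ 2 - a * b - 2 * a * c) ^ 3 =
    0 * (a ^ 2 * a ^ 2) + (-b - 6 * c) * (a ^ 2 * (a * b ^ 2)) + (-12 * c) * (a ^ 2 * (a * b * c)) +
      (-8) * (a ^ 2 * (a * c ^ 3)) + (3 * b + 12 * c) * (a ^ 2 * b ^ 3) + 12 * (a ^ 2 * (b ^ 2 * c ^ 2)) +
      0 * (a ^ 2 * (b * c ^ 4)) + (-3) * (a * b ^ 2 * b ^ 3) + 0 * (a * b ^ 2 * (b ^ 2 * c ^ 2)) +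
      (-6) * (a * b * c * b ^ 3) + 0 * (a * b * c * (b ^ 2 * c ^ 2)) + 1 * (b ^ 3 * b ^ 3) +
      0 * (b ^ 3 * (b ^ 2 * c ^ 2)) := by ring

/-- **`Δ₇`**: the combination `Σ b_{jk} g_j g_k` below (plan-1's 34-term invariant `Δ₇`, cofactor table
`mem2_Delta7`) satisfies `x_a² Δ₇ = T'H'³ − T'³ + 3x_aT'²H'` (`Delta7_def`). [folklore] -/
theorem delta7_relation :
    a ^ 2 * ((-2 * b ^ 3 - 6 * b ^ 2 * c + 9 * b ^ 2 * d + 36 * b * c * d - 54 * c * d ^ 2 - 27 * d ^ 3) *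
        (a ^ 2 * a ^ 2) +
      (4 * b ^ 2 - 3 * b * c - 21 * b * d - 24 * c ^ 2 - 18 * c * d + 27 * d ^ 2) * (a ^ 2 * (a * b ^ 2)) +
      (8 * c ^ 2 + 72 * c * d + 81 * d ^ 2) * (a ^ 2 * (a * b * c)) + (-24 * d) * (a ^ 2 * (a * c ^ 3)) +
      (21 * b * c + 9 * b * d + 6 * c ^ 2 - 54 * c * d - 27 * d ^ 2) * (a ^ 2 * b ^ 3) +
      (-18 * c - 45 * d) * (a ^ 2 * (b ^ 2 * c ^ 2)) + 24 * (a ^ 2 * (b * c ^ 4)) +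
      (-4 * b - 9 * c + 9 * d) * (a * b ^ 2 * b ^ 3) + 15 * (a * b ^ 2 * (b ^ 2 * c ^ 2)) +
      (36 * d) * (a * b * c * b ^ 3) + (-17) * (a * b * c * (b ^ 2 * c ^ 2)) +
      (2 * b - 3 * c - 6 * d) * (b ^ 3 * b ^ 3) + 3 * (b ^ 3 * (b ^ 2 * c ^ 2))) =
    (b ^ 3 - 3 * a * b * c + 3 * a ^ 2 * d - a ^ 2 * b) * (b ^ 2 - a * b - 2 * a * c) ^ 3 -
      (b ^ 3 - 3 * a * b * c + 3 * a ^ 2 * d - a ^ 2 * b) ^ 3 +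
      3 * a * (b ^ 3 - 3 * a * b * c + 3 * a ^ 2 * d - a ^ 2 * b) ^ 2 * (b ^ 2 - a * b - 2 * a * c) := by
  ring

end RingIdentities

section Memberships

variable (k : Type) [Field k] (n : ℕ) (a b c d : Fin n)

local notation3 "gI6" => (![X a ^ 2, X a * X b ^ 2, X a * X b * X c, X a * X c ^ 3, X b ^ 3,
  X b ^ 2 * X c ^ 2, X b * X c ^ 4, X c ^ 6] : Fin 8 → MvPolynomial (Fin n) k)
local notation3 "I6" => Ideal.span (Set.range gI6)
local notation3 "Tp" => (X b ^ 3 - 3 * X a * X b * X c + 3 * X a ^ 2 * X d - X a ^ 2 * X b :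
  MvPolynomial (Fin n) k)
local notation3 "Hp" => (X b ^ 2 - X a * X b - 2 * X a * X c : MvPolynomial (Fin n) k)
local notation3 "Mp" => (X b * X c - X b ^ 2 + X a * X b - 3 * X a * X d : MvPolynomial (Fin n) k)

/-- A combination `Σ c_j g_j` of the eight generators lies in `I₆`. [folklore] -/
theorem sum_mul_mem_I6 (c₀ c₁ c₂ c₃ c₄ c₅ c₆ c₇ : MvPolynomial (Fin n) k) :
    c₀ * (X a ^ 2) + c₁ * (X a * X b ^ 2) + c₂ * (X a * X b * X c) + c₃ * (X a * X c ^ 3) +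
      c₄ * (X b ^ 3) + c₅ * (X b ^ 2 * X c ^ 2) + c₆ * (X b * X c ^ 4) + c₇ * (X c ^ 6) ∈ I6 := by
  have h0 : (X a ^ 2 : MvPolynomial (Fin n) k) ∈ I6 := Ideal.subset_span ⟨0, rfl⟩
  have h1 : (X a * X b ^ 2 : MvPolynomial (Fin n) k) ∈ I6 := Ideal.subset_span ⟨1, rfl⟩
  have h2 : (X a * X b * X c : MvPolynomial (Fin n) k) ∈ I6 := Ideal.subset_span ⟨2, rfl⟩
  have h3 : (X a * X c ^ 3 : MvPolynomial (Fin n) k) ∈ I6 := Ideal.subset_span ⟨3, rfl⟩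
  have h4 : (X b ^ 3 : MvPolynomial (Fin n) k) ∈ I6 := Ideal.subset_span ⟨4, rfl⟩
  have h5 : (X b ^ 2 * X c ^ 2 : MvPolynomial (Fin n) k) ∈ I6 := Ideal.subset_span ⟨5, rfl⟩
  have h6 : (X b * X c ^ 4 : MvPolynomial (Fin n) k) ∈ I6 := Ideal.subset_span ⟨6, rfl⟩
  have h7 : (X c ^ 6 : MvPolynomial (Fin n) k) ∈ I6 := Ideal.subset_span ⟨7, rfl⟩
  exact Ideal.add_mem _ (Ideal.add_mem _ (Ideal.add_mem _ (Ideal.add_mem _ (Ideal.add_mem _ (Ideal.add_mem _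
    (Ideal.add_mem _ (Ideal.mul_mem_left _ _ h0) (Ideal.mul_mem_left _ _ h1)) (Ideal.mul_mem_left _ _ h2))
    (Ideal.mul_mem_left _ _ h3)) (Ideal.mul_mem_left _ _ h4)) (Ideal.mul_mem_left _ _ h5))
    (Ideal.mul_mem_left _ _ h6)) (Ideal.mul_mem_left _ _ h7)

/-- A combination `Σ c_{jk} g_j g_k` of products of generators lies in `I₆²` (the products that occur
in the cofactor tables). [folklore] -/
theorem sum_mul_mem_I6_sq (c₀₀ c₀₁ c₀₂ c₀₃ c₀₄ c₀₅ c₀₆ c₁₄ c₁₅ c₂₄ c₂₅ c₄₄ c₄₅ : MvPolynomial (Fin n) k) :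
    c₀₀ * (X a ^ 2 * X a ^ 2) + c₀₁ * (X a ^ 2 * (X a * X b ^ 2)) + c₀₂ * (X a ^ 2 * (X a * X b * X c)) +
      c₀₃ * (X a ^ 2 * (X a * X c ^ 3)) + c₀₄ * (X a ^ 2 * X b ^ 3) + c₀₅ * (X a ^ 2 * (X b ^ 2 * X c ^ 2)) +
      c₀₆ * (X a ^ 2 * (X b * X c ^ 4)) + c₁₄ * (X a * X b ^ 2 * X b ^ 3) +
      c₁₅ * (X a * X b ^ 2 * (X b ^ 2 * X c ^ 2)) + c₂₄ * (X a * X b * X c * X b ^ 3) +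
      c₂₅ * (X a * X b * X c * (X b ^ 2 * X c ^ 2)) + c₄₄ * (X b ^ 3 * X b ^ 3) +
      c₄₅ * (X b ^ 3 * (X b ^ 2 * X c ^ 2)) ∈ I6 ^ 2 := by
  have h0 : (X a ^ 2 : MvPolynomial (Fin n) k) ∈ I6 := Ideal.subset_span ⟨0, rfl⟩
  have h1 : (X a * X b ^ 2 : MvPolynomial (Fin n) k) ∈ I6 := Ideal.subset_span ⟨1, rfl⟩
  have h2 : (X a * X b * X c : MvPolynomial (Fin n) k) ∈ I6 := Ideal.subset_span ⟨2, rfl⟩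
  have h3 : (X a * X c ^ 3 : MvPolynomial (Fin n) k) ∈ I6 := Ideal.subset_span ⟨3, rfl⟩
  have h4 : (X b ^ 3 : MvPolynomial (Fin n) k) ∈ I6 := Ideal.subset_span ⟨4, rfl⟩
  have h5 : (X b ^ 2 * X c ^ 2 : MvPolynomial (Fin n) k) ∈ I6 := Ideal.subset_span ⟨5, rfl⟩
  have h6 : (X b * X c ^ 4 : MvPolynomial (Fin n) k) ∈ I6 := Ideal.subset_span ⟨6, rfl⟩
  have hp : ∀ u v : MvPolynomial (Fin n) k, u ∈ I6 → v ∈ I6 → u * v ∈ I6 ^ 2 := fun u v hu hv => by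
    rw [pow_two]; exact Ideal.mul_mem_mul hu hv
  have m := fun (w u v : MvPolynomial (Fin n) k) (hu : u ∈ I6) (hv : v ∈ I6) =>
    Ideal.mul_mem_left (I6 ^ 2) w (hp u v hu hv)
  exact Ideal.add_mem _ (Ideal.add_mem _ (Ideal.add_mem _ (Ideal.add_mem _ (Ideal.add_mem _ (Ideal.add_mem _
    (Ideal.add_mem _ (Ideal.add_mem _ (Ideal.add_mem _ (Ideal.add_mem _ (Ideal.add_mem _ (Ideal.add_mem _
    (m _ _ _ h0 h0) (m _ _ _ h0 h1)) (m _ _ _ h0 h2)) (m _ _ _ h0 h3)) (m _ _ _ h0 h4)) (m _ _ _ h0 h5))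
    (m _ _ _ h0 h6)) (m _ _ _ h1 h4)) (m _ _ _ h1 h5)) (m _ _ _ h2 h4)) (m _ _ _ h2 h5)) (m _ _ _ h4 h4))
    (m _ _ _ h4 h5)

/-- `T' ∈ I₆` (plan-1 `mem1_Tprime`). [folklore] -/
theorem Tprime_mem_I6 : Tp ∈ I6 := by
  rw [tprime_eq_cofactors]; exact sum_mul_mem_I6 k n a b c _ _ _ _ _ _ _ _

/-- `H'² ∈ I₆` (plan-1 `mem1_Hsq`). [folklore] -/
theorem Hsq_mem_I6 : Hp ^ 2 ∈ I6 := by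
  rw [hsq_eq_cofactors]; exact sum_mul_mem_I6 k n a b c _ _ _ _ _ _ _ _

/-- `x_a H' ∈ I₆` (plan-1 `mem1_xaH`). [folklore] -/
theorem xaH_mem_I6 : X a * Hp ∈ I6 := by
  rw [xaH_eq_cofactors]; exact sum_mul_mem_I6 k n a b c _ _ _ _ _ _ _ _

/-- `M H' ∈ I₆` (plan-1 `mem1_MH`). [folklore] -/
theorem MH_mem_I6 : Mp * Hp ∈ I6 := by
  rw [mH_eq_cofactors]; exact sum_mul_mem_I6 k n a b c _ _ _ _ _ _ _ _

/-- `x_a M ∈ I₆` (plan-1 `mem1_xaM`). [folklore] -/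
theorem xaM_mem_I6 : X a * Mp ∈ I6 := by
  rw [xaM_eq_cofactors]; exact sum_mul_mem_I6 k n a b c _ _ _ _ _ _ _ _

/-- `M² ∈ I₆` (plan-1 `mem1_Msq`). [folklore] -/
theorem Msq_mem_I6 : Mp ^ 2 ∈ I6 := by
  rw [msq_eq_cofactors]; exact sum_mul_mem_I6 k n a b c _ _ _ _ _ _ _ _

/-- `H'³ ∈ I₆²` (every monomial has `(3,2,1)`-weight `≥ 12`; plan-1 `mem2_Hcube`). [folklore] -/
theorem Hcube_mem_I6_sq : Hp ^ 3 ∈ I6 ^ 2 := by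
  rw [hcube_eq_cofactors]; exact sum_mul_mem_I6_sq k n a b c _ _ _ _ _ _ _ _ _ _ _ _ _

/-- `T'² ∈ I₆²`. [folklore] -/
theorem Tprime_sq_mem_I6_sq : Tp ^ 2 ∈ I6 ^ 2 :=
  Ideal.pow_mem_pow (Tprime_mem_I6 k n a b c d) 2

/-- **The invariant `Δ₇`**: there is `Δ₇ ∈ I₆²` with `x_a² Δ₇ = T'H'³ − T'³ + 3x_aT'²H'` (plan-1
`Delta7_def`, `mem2_Delta7`); on the twisted chart `Δ₇ ↦ s¹²Q³η`, which recovers `η`. [folklore] -/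
theorem exists_Delta7_mem_I6_sq : ∃ Δ ∈ I6 ^ 2,
    X a ^ 2 * Δ = Tp * Hp ^ 3 - Tp ^ 3 + 3 * X a * Tp ^ 2 * Hp :=
  ⟨_, sum_mul_mem_I6_sq k n a b c _ _ _ _ _ _ _ _ _ _ _ _ _, delta7_relation (X a) (X b) (X c) (X d)⟩

end Memberships

end Summit.ResolutionOfSingularities.ResolutionOfSingularities.Theorems.WildQuotientResolution.JordanFour

end
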